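import Mathlib
import Summits.Ventures.HodgeRepro.CMType
import Summits.Ventures.HodgeRepro.HodgeSets
import Summits.Ventures.HodgeRepro.CMRank
import Summits.Ventures.HodgeRepro.MuTable

/-!
# Deligne's Lemma 5.2 in the μ-table (blind cell `pub-hodge-repro`, seat p2)

Deligne, LNM 900 §5 (TeX p. 40), Lemma 5.2 (first part): for the family `(A_Φ)` of all CM types of a
Galois CM field, the characters orthogonal to the Galois orbit of `μ = Σ_{s,Φ} Φ(s) y_{s,Φ} + y_0` are
exactly `x = Σ_Φ d(Φ) x_{s₀,Φ} − (d/2) x_0` with `Σ_Φ d(Φ) Φ = d/2` (a constant function on `S`), since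
`⟨σμ, x⟩ = Σ_Φ d(Φ) Φ(σ⁻¹ s₀) − d/2`.  In the μ-table: `muPairFam Φ (single s₀ d) n₀ σ = 0` for all `σ`
iff `Σ_i d(i) [s ∈ Φ_i] = −n₀` for all `s`.
-/

set_option autoImplicit false

open Finset
open scoped Pointwise

namespace HodgeRepro

variable {G : Type*} [Group G] [DecidableEq G] {ι : Type*} [Fintype ι]

/-- Deligne's `x = Σ_i d(i) x_{s₀,i} + n₀ x₀` as a character `G → ι → ℤ` plus constant term. -/
def deligneChar (s₀ : G) (d : ι → ℤ) : G → ι → ℤ := fun s i => if s = s₀ then d i else 0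

/-- Orthogonality to the Galois orbit of `μ` (`⟨σμ, x⟩ = 0` for all `σ`). -/
def IsOrthogonalToOrbit (Φ : ι → Finset G) (n : G → ι → ℤ) (n₀ : ℤ) : Prop :=
  ∀ σ : G, muPairFam Φ n n₀ σ = 0

/-- **Lemma 5.2, first part.**  `x = Σ_i d(i) x_{s₀,i} + n₀ x₀` is orthogonal to the orbit of `μ` iff the
weighted sum of the types `Σ_i d(i) Φ_i` is the constant function `−n₀` (Deligne: `Σ d(Φ)Φ = d/2` with
`n₀ = −d/2`). -/
theorem isOrthogonalToOrbit_deligneChar_iff (Φ : ι → Finset G) (d : ι → ℤ) (n₀ : ℤ) (s₀ : G) :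
    IsOrthogonalToOrbit Φ (deligneChar s₀ d) n₀ ↔
      ∀ s : G, ∑ i, d i * (if s ∈ Φ i then 1 else 0) = -n₀ := by
  unfold IsOrthogonalToOrbit deligneChar
  constructor
  · intro h s
    have := h (s₀ * s⁻¹)
    rw [muPairFam_single] at this
    have hs : (s₀ * s⁻¹)⁻¹ * s₀ = s := by group
    rw [hs] at this
    linarith
  · intro h σ
    rw [muPairFam_single, h (σ⁻¹ * s₀)]
    ring

/-- The pair `(Φ, c • Φ)` with multiplicities `(1, 1)` and constant term `−1` is orthogonal to the orbit
(Deligne: "`x_{s₀,Φ} + x_{s₀,Φ̄} − x_0 ∈ Y(G^H)^⊥`"). -/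
theorem isOrthogonalToOrbit_pair_conj [Fintype G] {c : G} {Φ : Finset G} (hc : IsComplexConj c)
    (hΦ : IsCMType c Φ) (s₀ : G) :
    IsOrthogonalToOrbit (![Φ, c • Φ] : Fin 2 → Finset G) (deligneChar s₀ (fun _ => 1)) (-1) := by
  rw [isOrthogonalToOrbit_deligneChar_iff]
  intro s
  simp only [Fin.sum_univ_two, Matrix.cons_val_zero, Matrix.cons_val_one, one_mul, neg_neg]
  rw [hΦ.smul_eq_compl hc]
  simp only [mem_compl]
  by_cases h : s ∈ Φ <;> simp [h]

/-- A family of CM types with `Σ_i Φ_i = p` (constant) gives an orthogonal character with `n₀ = −p`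
(Deligne §5 (c): the product `∏ A_{Φ_i}` then carries the split-Weil line). -/
theorem isOrthogonalToOrbit_of_sum_const (Φ : ι → Finset G) (p : ℕ)
    (hp : ∀ s : G, (univ.filter fun i => s ∈ Φ i).card = p) (s₀ : G) :
    IsOrthogonalToOrbit Φ (deligneChar s₀ (fun _ => 1)) (-(p : ℤ)) := by
  rw [isOrthogonalToOrbit_deligneChar_iff]
  intro s
  simp only [one_mul, neg_neg]
  rw [← hp s, card_filter]
  push_cast
  rfl

end HodgeRepro
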